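import Summits.NavierStokesRegularity.NavierStokesRegularity.Theorems.LerayQuarterDissipationRecurrentDissipativeLiouvilleCriticalRecurrent
import Summits.NavierStokesRegularity.NavierStokesRegularity.Theorems.LerayQuarterDissipationFiniteDissipationLiouvilleHullCategoryMinimal
import Summits.NavierStokesRegularity.NavierStokesRegularity.Theorems.LerayQuarterDissipationFiniteDissipationLiouvillePersistenceSeq
import Mathlib.Analysis.SpecialFunctions.JapaneseBracket
import HarnessLib

/-!
# Crux `FiniteDissipationLiouville` (stmt-NavierStokesRegularity-22144), line `birth`:
# THE EXTREMAL CRITICAL ELEMENT — Leray's dissipation law is ATTAINED: a singular, uniformly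
# recurrent member of `𝒟_{C,K_c}` with `∫‖∇W(−1)‖² = K_c` exactly

Helper file (theorems only, `--supports` the crux). `𝒟_{C,K}` = Type-I ancient mild fields in the
KNSS gauge with the quarter-rate law `∫‖∇w(s)‖² ≤ K/√(−s)`; `K_c` = the critical (least) constant
with a singular member for the Type-I constant `C` (`…CriticalElement`). CENSUS-g7 recorded the
EXTREMAL ELEMENT (exact saturation of the law at one slice) as dead «on the per-profile constants of
`ScaleInvariantBounds` (needs `L₁` uniform across members for dominated convergence)». This file
repairs it: uniformity is not needed ACROSS MEMBERS, only along ONE scaling orbit and its limits —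
and the gradient envelope `‖∇w(t,x)‖ ≤ L/(‖x‖ + √(−t))²` is SCALE INVARIANT (same `L` for every
`w_c`) and CLOSED under the pointwise convergence of gradients delivered by KNSS compactness
(`Compactness.seqLimit`). So:

* `exists_extremal_of_minimal` — if `K_c` is critical for `C` and `w ∈ 𝒟_{C,K_c}` is singular,
  uniformly recurrent and has a gradient envelope `L`, then some scaling limit `W ∈ 𝒟_{C,K_c}` of `w`
  — again SINGULAR (persistence), UNIFORMLY RECURRENT (minimality of the hull, lead g11), with the
  same envelope — ATTAINS the law: `∫‖∇W(−1)‖² = K_c` (by minimality `sup_s √(−s)∫‖∇w(s)‖² = K_c`,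
  `CriticalElement.exists_slice_gt_of_minimal`; rescale the almost-saturating slices to `t = −1`;
  extract a limit; dominated convergence under the uniform envelope `L²/(1+‖x‖)⁴ ∈ L¹(ℝ³)` keeps the
  dissipation, Fatou/`law_of_seqLimit` keeps the law). Equivalently `t ↦ √(−t)∫‖∇W(t)‖²` has a
  MAXIMUM, `K_c`, at `t = −1` (`dissipation_le_extremal`): a variational characterisation of the
  critical element — the analogue of the attained critical norm of a Kenig–Merle minimal element —
  whose first-order condition at the extremal slice is the exact balance
  `‖ΔU‖² + K_c/4 = ∫(U·∇U)·ΔU` of the period enstrophy identity (census; not typed).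

PORTRAIT (a new clause of variational type; no scenario excluded; verdict FRONTIER unchanged). No
summit is proved by this file; Navier–Stokes regularity is NOT proved by anything here.

References: C. E. Kenig, F. Merle, Invent. Math. 166 (2006) (critical element with attained critical
norm — the pattern) [KenigMerle2006]; G. Koch, N. Nadirashvili, G. Seregin, V. Šverák, Acta Math.
203 (2009) = arXiv:0709.3599, §4 (compactness) [KochNadirashviliSereginSverak2009].
-/

noncomputable section

-- the summit and its single problem share the name (D-0017 nested layout)
set_option linter.dupNamespace false

namespace Summit.NavierStokesRegularity.NavierStokesRegularity.Theorems.FiniteDissipationLiouville.Extremal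

open scoped Topology ENNReal
open MeasureTheory Set Function Filter Metric TopologicalSpace Topology
open Literature.Analysis.FluidPDE
open Summit.NavierStokesRegularity.NavierStokesRegularity.Theorems.RecurrentReductionD

/-- **The gradient envelope `‖∇w(t,x)‖ ≤ L/(‖x‖+√(−t))²` is scale invariant**: it holds for every
rescaling `w_c`, `c > 0`, with the same constant. [folklore] -/
theorem gradEnvelope_nsRescale {L c : ℝ} (hc : 0 < c)
    {w : ℝ → EuclideanSpace ℝ (Fin 3) → EuclideanSpace ℝ (Fin 3)}
    (hgrad : ∀ t : ℝ, t < 0 → ∀ x, ‖fderiv ℝ (w t) x‖ ≤ L / (‖x‖ + Real.sqrt (-t)) ^ 2) :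
    ∀ t : ℝ, t < 0 → ∀ x, ‖fderiv ℝ (nsRescale c w t) x‖ ≤ L / (‖x‖ + Real.sqrt (-t)) ^ 2 := by
  intro t ht x
  have hct : c ^ 2 * t < 0 := mul_neg_of_pos_of_neg (by positivity) ht
  have hs : 0 < Real.sqrt (-t) := Real.sqrt_pos.2 (neg_pos.2 ht)
  have hden : 0 < ‖x‖ + Real.sqrt (-t) := add_pos_of_nonneg_of_pos (norm_nonneg _) hs
  have hsq : Real.sqrt (-(c ^ 2 * t)) = c * Real.sqrt (-t) := by
    rw [show -(c ^ 2 * t) = c ^ 2 * (-t) by ring, Real.sqrt_mul (sq_nonneg c), Real.sqrt_sq hc.le]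
  have h1 := hgrad (c ^ 2 * t) hct (c • x)
  rw [norm_smul, Real.norm_of_nonneg hc.le, hsq, ← mul_add, mul_pow] at h1
  rw [fderiv_nsRescale, norm_smul, Real.norm_of_nonneg (mul_self_nonneg c)]
  calc c * c * ‖fderiv ℝ (w (c ^ 2 * t)) (c • x)‖
      ≤ c * c * (L / (c ^ 2 * (‖x‖ + Real.sqrt (-t)) ^ 2)) :=
        mul_le_mul_of_nonneg_left h1 (mul_self_nonneg c)
    _ = L / (‖x‖ + Real.sqrt (-t)) ^ 2 := by
        field_simp

/-- **THE EXTREMAL CRITICAL ELEMENT: the dissipation law is attained.** Let `K_c` be critical for the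
Type-I constant `C` (no member of `𝒟_{C,K'}`, `K' < K_c`, is singular) and let `w ∈ 𝒟_{C,K_c}` be
SINGULAR at the origin, UNIFORMLY RECURRENT, with the gradient envelope
`‖∇w(t,x)‖ ≤ L/(‖x‖ + √(−t))²`. Then some scaling limit `W ∈ 𝒟_{C,K_c}` of `w` (uniform on the
slab pieces and pointwise, along rescalings `w_{l_k}`) is SINGULAR, UNIFORMLY RECURRENT, has the same
gradient envelope, and SATURATES Leray's law at `t = −1`: `∫‖∇W(−1)‖² = K_c`. Proof: minimality
gives slices `s_j` with `√(−s_j)∫‖∇w(s_j)‖² > K_c − 1/(j+1)` (`exists_slice_gt_of_minimal`);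
rescale them to `t = −1`; KNSS compactness (`Compactness.seqLimit`, gradients converge pointwise);
the scale-invariant envelope dominates by `L²/(1+‖x‖)⁴ ∈ L¹(ℝ³)`, so the dissipation at `t = −1`
passes to the limit; the law, the singularity and the recurrence persist (`law_of_seqLimit`,
`persistent_singularity_seq`, `HullCategory.recurrent_of_orbitLimit`).
[cite: KenigMerle2006, §4 (critical element; compactness ⇒ attained critical level) — pattern only]
[cite: KochNadirashviliSereginSverak2009, Prop. 4.1 and Lemma 6.1 (arXiv:0709.3599 pp. 8, 11)] -/
theorem exists_extremal_of_minimal {C Kc L : ℝ}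
    (hmin : ∀ K' : ℝ, K' < Kc → ∀ v : ℝ → EuclideanSpace ℝ (Fin 3) → EuclideanSpace ℝ (Fin 3),
      IsTypeIAncientMild C v →
      (∀ s : ℝ, s < 0 → ∫⁻ x, ‖fderiv ℝ (v s) x‖ₑ ^ 2 ≤ ENNReal.ofReal (K' / Real.sqrt (-s))) →
      ¬ (∀ r > 0, ∀ M : ℝ, ∃ t ∈ Set.Ioo (-(r ^ 2)) (0 : ℝ),
        ∃ x ∈ Metric.ball (0 : EuclideanSpace ℝ (Fin 3)) r, M < ‖v t x‖))
    {w : ℝ → EuclideanSpace ℝ (Fin 3) → EuclideanSpace ℝ (Fin 3)} (hw : IsTypeIAncientMild C w)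
    (hDw : ∀ s : ℝ, s < 0 → ∫⁻ x, ‖fderiv ℝ (w s) x‖ₑ ^ 2 ≤ ENNReal.ofReal (Kc / Real.sqrt (-s)))
    (hsw : ∀ r > 0, ∀ M : ℝ, ∃ t ∈ Ioo (-(r ^ 2)) (0 : ℝ),
      ∃ x ∈ ball (0 : EuclideanSpace ℝ (Fin 3)) r, M < ‖w t x‖)
    (hrec : ∀ ε > 0, ∀ R > 1, ∃ L > 0, ∀ a : ℝ, ∃ σ ∈ Icc a (a + L),
      ∀ s ∈ Icc (-(R ^ 2)) (-(R⁻¹) ^ 2), ∀ y ∈ closedBall (0 : EuclideanSpace ℝ (Fin 3)) R,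
        ‖Real.exp σ • w (Real.exp (2 * σ) * s) (Real.exp σ • y) - w s y‖ ≤ ε)
    (hgrad : ∀ t : ℝ, t < 0 → ∀ x, ‖fderiv ℝ (w t) x‖ ≤ L / (‖x‖ + Real.sqrt (-t)) ^ 2) :
    ∃ W : ℝ → EuclideanSpace ℝ (Fin 3) → EuclideanSpace ℝ (Fin 3),
      IsTypeIAncientMild C W ∧
      (∀ s : ℝ, s < 0 → ∫⁻ x, ‖fderiv ℝ (W s) x‖ₑ ^ 2 ≤ ENNReal.ofReal (Kc / Real.sqrt (-s))) ∧
      (∀ r > 0, ∀ M : ℝ, ∃ t ∈ Ioo (-(r ^ 2)) (0 : ℝ),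
        ∃ x ∈ ball (0 : EuclideanSpace ℝ (Fin 3)) r, M < ‖W t x‖) ∧
      (∀ ε > 0, ∀ R > 1, ∃ L > 0, ∀ a : ℝ, ∃ σ ∈ Icc a (a + L),
        ∀ s ∈ Icc (-(R ^ 2)) (-(R⁻¹) ^ 2), ∀ y ∈ closedBall (0 : EuclideanSpace ℝ (Fin 3)) R,
          ‖Real.exp σ • W (Real.exp (2 * σ) * s) (Real.exp σ • y) - W s y‖ ≤ ε) ∧
      (∃ l : ℕ → ℝ, (∀ k, 0 < l k) ∧
        (∀ n : ℕ, TendstoUniformlyOn (fun k z => nsRescale (l k) w z.1 z.2) (fun z => W z.1 z.2)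
          atTop (Icc (-((n : ℝ) + 2)) (-(1 / ((n : ℝ) + 2))) ×ˢ
            closedBall (0 : EuclideanSpace ℝ (Fin 3)) ((n : ℝ) + 2))) ∧
        ∀ t < 0, ∀ x, Tendsto (fun k => nsRescale (l k) w t x) atTop (𝓝 (W t x))) ∧
      (∀ t : ℝ, t < 0 → ∀ x, ‖fderiv ℝ (W t) x‖ ≤ L / (‖x‖ + Real.sqrt (-t)) ^ 2) ∧
      ∫⁻ x, ‖fderiv ℝ (W (-1)) x‖ₑ ^ 2 = ENNReal.ofReal Kc := by
  -- ## almost-saturating slices, by minimality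
  have hsl : ∀ j : ℕ, ∃ s : ℝ, s < 0 ∧
      ENNReal.ofReal ((Kc - 1 / ((j : ℝ) + 1)) / Real.sqrt (-s)) < ∫⁻ x, ‖fderiv ℝ (w s) x‖ₑ ^ 2 :=
    fun j => CriticalElement.exists_slice_gt_of_minimal hmin hw hsw
      (K' := Kc - 1 / ((j : ℝ) + 1)) (sub_lt_self Kc (by positivity))
  choose s hs hlt using hsl
  -- ## rescale them to `t = -1`
  set c : ℕ → ℝ := fun j => Real.sqrt (-s j) with hc
  have hc0 : ∀ j, 0 < c j := fun j => Real.sqrt_pos.2 (neg_pos.2 (hs j))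
  have hc2 : ∀ j, c j ^ 2 * (-1) = s j := fun j => by
    rw [hc, Real.sq_sqrt (neg_pos.2 (hs j)).le]; ring
  set V : ℕ → ℝ → EuclideanSpace ℝ (Fin 3) → EuclideanSpace ℝ (Fin 3) :=
    fun j => nsRescale (c j) w with hV
  have hVk : ∀ j, IsTypeIAncientMild C (V j) := fun j => isTypeIAncientMild_nsRescale hw (hc0 j)
  have hVlaw : ∀ j, ∀ s : ℝ, s < 0 →
      ∫⁻ x, ‖fderiv ℝ (V j s) x‖ₑ ^ 2 ≤ ENNReal.ofReal (Kc / Real.sqrt (-s)) :=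
    fun j => dissipationLaw_nsRescale hDw (hc0 j)
  have hVsing : ∀ j, ∀ r > 0, ∀ M : ℝ, ∃ t ∈ Ioo (-(r ^ 2)) (0 : ℝ),
      ∃ x ∈ ball (0 : EuclideanSpace ℝ (Fin 3)) r, M < ‖V j t x‖ :=
    fun j => singularAtOrigin_nsRescale hsw (hc0 j)
  have hVgrad : ∀ j, ∀ t : ℝ, t < 0 → ∀ x,
      ‖fderiv ℝ (V j t) x‖ ≤ L / (‖x‖ + Real.sqrt (-t)) ^ 2 :=
    fun j => gradEnvelope_nsRescale (hc0 j) hgrad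
  -- the rescaled slices at `t = -1` almost saturate `K_c`
  have hVlow : ∀ j : ℕ, ENNReal.ofReal (Kc - 1 / ((j : ℝ) + 1)) ≤ ∫⁻ x, ‖fderiv ℝ (V j (-1)) x‖ₑ ^ 2 := by
    intro j
    rw [hV, lintegral_fderiv_nsRescale_sq (hc0 j), hc2 j]
    have e : Kc - 1 / ((j : ℝ) + 1) = c j * ((Kc - 1 / ((j : ℝ) + 1)) / c j) := by
      rw [mul_div_cancel₀ _ (hc0 j).ne']
    rw [e, ENNReal.ofReal_mul (hc0 j).le]
    exact mul_le_mul_right (hlt j).le _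
  -- ## KNSS compactness: a limit with converging gradients
  obtain ⟨ψ, hψ, W, hW, hWu, hpt, hgr⟩ := Compactness.seqLimit hVk
  have hψt : Tendsto ψ atTop atTop := hψ.tendsto_atTop
  have hlawW : ∀ s : ℝ, s < 0 → ∫⁻ x, ‖fderiv ℝ (W s) x‖ₑ ^ 2 ≤ ENNReal.ofReal (Kc / Real.sqrt (-s)) :=
    Compactness.law_of_seqLimit (Kk := fun _ => Kc) hψt hVlaw
      (fun ε hε => Eventually.of_forall fun _ => le_add_of_nonneg_right hε.le) hgr
  have hsingW := Compactness.persistent_singularity_seq (fun j => hVk (ψ j)) (fun j => hVlaw (ψ j))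
    (fun j => hVsing (ψ j)) hW hWu
  have hrecW := HullCategory.recurrent_of_orbitLimit hw hDw hrec (fun j => c (ψ j)) (fun j => hc0 _)
    hW hlawW hWu
  have hgradW : ∀ t : ℝ, t < 0 → ∀ x, ‖fderiv ℝ (W t) x‖ ≤ L / (‖x‖ + Real.sqrt (-t)) ^ 2 :=
    fun t ht x => le_of_tendsto (hgr t ht x).norm (Eventually.of_forall fun j => hVgrad (ψ j) t ht x)
  refine ⟨W, hW, hlawW, hsingW, hrecW, ⟨fun j => c (ψ j), fun j => hc0 _, hWu, hpt⟩, hgradW, ?_⟩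
  -- ## the dissipation at `t = -1` passes to the limit (dominated convergence) and equals `K_c`
  refine le_antisymm ?_ ?_
  · have h := hlawW (-1) (by norm_num)
    rwa [neg_neg, Real.sqrt_one, div_one] at h
  · have h1 : (-1 : ℝ) < 0 := by norm_num
    -- domination by `L² (1 + ‖x‖)^{-4} ∈ L¹(ℝ³)`
    have hdom : ∀ j x, ‖fderiv ℝ (V (ψ j) (-1)) x‖ₑ ^ 2 ≤
        ENNReal.ofReal (L ^ 2 * (1 + ‖x‖) ^ (-(4 : ℝ))) := by
      intro j x
      have hb := hVgrad (ψ j) (-1) h1 x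
      rw [neg_neg, Real.sqrt_one] at hb
      rw [← ofReal_norm, ← ENNReal.ofReal_pow (norm_nonneg _)]
      refine ENNReal.ofReal_le_ofReal ?_
      have hpos : 0 < 1 + ‖x‖ := by positivity
      calc ‖fderiv ℝ (V (ψ j) (-1)) x‖ ^ 2 ≤ (L / (‖x‖ + 1) ^ 2) ^ 2 :=
            pow_le_pow_left₀ (norm_nonneg _) hb 2
        _ = L ^ 2 * (1 + ‖x‖) ^ (-(4 : ℝ)) := by
            rw [Real.rpow_neg hpos.le, show (4 : ℝ) = ((4 : ℕ) : ℝ) by norm_num,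
              Real.rpow_natCast, div_pow, ← pow_mul, add_comm ‖x‖ 1]
            ring
    have hfin : ∫⁻ x : EuclideanSpace ℝ (Fin 3), ENNReal.ofReal (L ^ 2 * (1 + ‖x‖) ^ (-(4 : ℝ))) ≠ ∞ := by
      have h3 : (Module.finrank ℝ (EuclideanSpace ℝ (Fin 3)) : ℝ) < 4 := by
        rw [finrank_euclideanSpace, Fintype.card_fin]; norm_num
      have h4 := finite_integral_one_add_norm (μ := (volume : Measure (EuclideanSpace ℝ (Fin 3)))) h3
      have e : ∀ x : EuclideanSpace ℝ (Fin 3), ENNReal.ofReal (L ^ 2 * (1 + ‖x‖) ^ (-(4 : ℝ))) =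
          ENNReal.ofReal (L ^ 2) * ENNReal.ofReal ((1 + ‖x‖) ^ (-(4 : ℝ))) := fun x =>
        ENNReal.ofReal_mul (sq_nonneg L)
      simp_rw [e]
      rw [lintegral_const_mul _ (by fun_prop)]
      exact (ENNReal.mul_lt_top ENNReal.ofReal_lt_top h4).ne
    have hlim : Tendsto (fun j => ∫⁻ x, ‖fderiv ℝ (V (ψ j) (-1)) x‖ₑ ^ 2) atTop
        (𝓝 (∫⁻ x, ‖fderiv ℝ (W (-1)) x‖ₑ ^ 2)) := by
      refine tendsto_lintegral_of_dominated_convergence _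
        (fun j => (measurable_fderiv ℝ (V (ψ j) (-1))).enorm.pow_const 2)
        (fun j => Eventually.of_forall fun x => hdom j x) hfin (Eventually.of_forall fun x => ?_)
      exact ((ENNReal.continuous_pow 2).tendsto _).comp (hgr (-1) h1 x).enorm
    have hlow : Tendsto (fun j => ENNReal.ofReal (Kc - 1 / (((ψ j : ℕ) : ℝ) + 1))) atTop
        (𝓝 (ENNReal.ofReal Kc)) := by
      refine ENNReal.tendsto_ofReal ?_
      have h0 : Tendsto (fun j => 1 / (((ψ j : ℕ) : ℝ) + 1)) atTop (𝓝 0) :=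
        (tendsto_one_div_add_atTop_nhds_zero_nat (𝕜 := ℝ)).comp hψt
      simpa using (tendsto_const_nhds (x := Kc)).sub h0
    exact le_of_tendsto_of_tendsto' hlow hlim fun j => hVlow (ψ j)

/-- **The extremal slice maximises the dimensionless dissipation**: for the element of
`exists_extremal_of_minimal`, `√(−t) ∫‖∇W(t)‖² ≤ K_c = ∫‖∇W(−1)‖²` for every `t < 0` — the function
`t ↦ √(−t)∫‖∇W(t)‖²` attains its supremum at `t = −1` (so its first variation along the flow
vanishes there; the census records the resulting balance `‖ΔU‖² + K_c/4 = ∫(U·∇U)·ΔU` of the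
period enstrophy identity at the extremal slice). [folklore] -/
theorem dissipation_le_extremal {Kc : ℝ}
    {W : ℝ → EuclideanSpace ℝ (Fin 3) → EuclideanSpace ℝ (Fin 3)}
    (hlawW : ∀ s : ℝ, s < 0 → ∫⁻ x, ‖fderiv ℝ (W s) x‖ₑ ^ 2 ≤ ENNReal.ofReal (Kc / Real.sqrt (-s)))
    (hsat : ∫⁻ x, ‖fderiv ℝ (W (-1)) x‖ₑ ^ 2 = ENNReal.ofReal Kc) {t : ℝ} (ht : t < 0) :
    ENNReal.ofReal (Real.sqrt (-t)) * ∫⁻ x, ‖fderiv ℝ (W t) x‖ₑ ^ 2 ≤ ∫⁻ x, ‖fderiv ℝ (W (-1)) x‖ₑ ^ 2 := by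
  have hs : 0 < Real.sqrt (-t) := Real.sqrt_pos.2 (neg_pos.2 ht)
  rw [hsat]
  rcases le_or_gt 0 Kc with hK | hK
  · calc ENNReal.ofReal (Real.sqrt (-t)) * ∫⁻ x, ‖fderiv ℝ (W t) x‖ₑ ^ 2
        ≤ ENNReal.ofReal (Real.sqrt (-t)) * ENNReal.ofReal (Kc / Real.sqrt (-t)) :=
          mul_le_mul_right (hlawW t ht) _
      _ = ENNReal.ofReal Kc := by
          rw [← ENNReal.ofReal_mul hs.le, mul_div_cancel₀ _ hs.ne']
  · have h0 : ∫⁻ x, ‖fderiv ℝ (W t) x‖ₑ ^ 2 = 0 := by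
      have h := hlawW t ht
      rw [ENNReal.ofReal_of_nonpos (div_nonpos_of_nonpos_of_nonneg hK.le hs.le)] at h
      exact le_antisymm h bot_le
    rw [h0, mul_zero]
    exact bot_le

end Summit.NavierStokesRegularity.NavierStokesRegularity.Theorems.FiniteDissipationLiouville.Extremal

end
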